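/-
Copyright (c) 2026 the pub-hodgecm-mathlib formalisation cell (harness21).  Prover seat hodgecm-mathlib-F0P3a-p01 (g32), req620 Track A «(D-RAM) FOUR-FRAME» squad, unit U2H:
the (ρ2b′-X) child `stub_U2H_fixedPointCensus_typeTwo_unit0` (U2H ED. 15 :418) — organ T3-E «LINE-MODEL EXISTENCE» (LH4-p12 (g4) 04:01Z «T3-E IS YOURS»; payer of record
LH4-p14 (g3), RHO2BX-ORDER v1; dealer LH4-plan (g12)): the ALGEBRAIC CORE — the line model `φ` and the form scalar `h` from eigen-data, over abstract fields.  2026-09-04.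
-/
import Literature.NumberTheory.Automorphic.UnitaryLatticeTreeDefs   -- ★ `pairing σ H` (the σ-sesquilinear pairing of a Gram matrix)
import HarnessLib

/-!
# Crux `H413`, line LH4 «(D-RAM) FOUR-FRAME» road — unit U2H, (ρ2b′-X), organ T3-E: THE ELLIPTIC PLANE AS A FIELD LINE — EXISTENCE OF THE LINE MODEL (algebraic core)

Cell `hodgecm-mathlib` (D-0151), FLOOR 0, crux item H413 = `stmt-HodgeConjecture-24833`, route of record `HCCMUnconditional`; squad F0∕P3c∕LH4; registered stub served:
`F0P3cDyRamFourFrameU2H.stub_U2H_fixedPointCensus_typeTwo_unit0` ((ρ2b′-X), U2H ED. 15 :418), through LH4-p14 (g3)'s ★ layers p857061∕p857086∕p857104∕p857119 and LH4-p12 (g4)'s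
organ O-W∕T3-T `EllipticPlaneAsFieldLine` (★ D1–D4 p857203, (C) `ncard_selfDual_fixed_eq_ncard_orderLatt`), whose binders `(φ, lam, h)` — the LINE MODEL of the plane — this organ
T3-E supplies.  THEOREMS ONLY (no `def`, no instance, no notation, no `sorry`); lane `--supports stmt-HodgeConjecture-24833 --as helper` (count-neutral).
THE MATHEMATICS (LH4-p12 (g3) PAYER-PLAN v2 D1–D2, LH4-p12 (g4) 04:01Z construction hint).  Abstract fields `E ⊂ M` (`jE : E →+* M`), `ρ Θ : M →+* M` with `ρ ∘ jE = jE`,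
`Θ ∘ jE = jE ∘ σ`; an element `lam ∈ M` with `lam² = t·lam − D`, `ρ lam = t − lam`, `Θ(lam)·lam = 1`, and UNIQUE coordinates `z = jE p + jE q·lam` on `M`; a `2 × 2` matrix `γ₂` over
`E` with trace `t`, determinant `D ≠ 0`, NO eigenvalue in `E` (`c² − tc + D ≠ 0`), unitary for the pairing of a Gram matrix `H₂`, and `t² ≠ 4D`.  Then with `e₀ = (1, 0)`:
* `φ(x) := jE a(x) + jE b(x)·lam` for the coordinates `x = a(x)·e₀ + b(x)·γ₂e₀` (`b = x₁∕γ₁₀`, `a = x₀ − b·γ₀₀`; `γ₁₀ ≠ 0` since `e₀` is no eigenvector) is additive, `φ(c•x) = jE c·φ x`,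
  bijective (unique coordinates), and `φ(γ₂ x) = lam·φ x` (Cayley–Hamilton: `γ₂² = tγ₂ − D`);
* `h := jE p + jE q·lam` with `p = (A t² − 2AD − tB)∕Δ`, `q = (2B − tA)∕Δ`, `Δ = t² − 4D`, `A = ⟨e₀,e₀⟩`, `B = ⟨e₀, γ₂e₀⟩` solves `T(h) = jE A`, `T(h·lam) = jE B` for `T(m) := m + ρ m`,
  whence `T(h·Θlam) = jE ⟨γ₂e₀, e₀⟩` (unitarity: `D·⟨γ₂e₀,e₀⟩ = ⟨γ₂e₀, γ₂(te₀ − γ₂e₀)⟩ = tA − B`, and `D·Θlam = t − lam`) and `T(h·Θlam·lam) = jE A = jE ⟨γ₂e₀,γ₂e₀⟩`; by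
  sesquilinearity `jE ⟨x, y⟩ = T(h·Θ(φx)·φy)` for all `x, y` — the binder `hform` of ★ (C).
No valuation enters: the metric half of T3-E (`|lam| = 1`, `hint`, `hjv`, `hjfix`) is the ★ eigen-field package of the square class of `disc χ_{γ₂}` (★ `TypeTwoEigenFieldPackage{,Wild,
Uniformiser}` ∕ ★ «LQC» `RamifiedQuadraticDictionary{,Wild}`), instantiated per class in T3-E part 2.
HONEST LABEL.  Count-neutral helper (pure algebra); (ρ2b′-X) stays an OPEN prover target until RHO2BX-ORDER v1's organs land; `HC_CM` is proved only modulo the 7 printed citations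
(2 remaining named inputs: hLiu418 = `stmt-HodgeConjecture-24832`, h413 = `stmt-HodgeConjecture-24833`) until rung 0 closes.

## References
* [Rogawski1990] J. D. Rogawski, *Automorphic Representations of Unitary Groups in Three Variables*, Ann. of Math. Stud. 123 (1990), §4.9 Lemma 4.9.3 p. 56 (the elliptic torus
  `T = E[γ]^{N=1}` of a regular element and its eigen-field), §3.6 pp. 28–29.
* [Jacobowitz1962] R. Jacobowitz, *Hermitian forms over local fields*, Amer. J. Math. 84 (1962), §4 (hermitian lines over a quadratic extension: `⟨a, b⟩ = Tr(h·ā·b)`).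
-/

set_option autoImplicit false

noncomputable section

namespace Summit.HodgeConjecture.HodgeConjecture.Cruxes.H413.F0P3cDyRamEllipticPlaneLineModel

open Matrix
open Literature.NumberTheory.Automorphic.UnitaryLatticeTree (pairing)
open scoped Matrix

variable {E M : Type*} [Field E] [Field M]

/-! ## §1 The pairing on basis vectors -/

/-- `pairing σ H x y = Σ_{i,j} σ(x_i) H_{ij} y_j` (the defining formula, for `rw`). [cite: Jacobowitz1962, §4] -/
theorem pairing_apply (σ : E →+* E) (H : Matrix (Fin 2) (Fin 2) E) (x y : Fin 2 → E) :
    pairing σ H x y = ∑ i, ∑ j, σ (x i) * H i j * y j := rfl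

/-- Sesquilinear expansion of the pairing along a decomposition `x = a•u + b•v`, `y = a'•u + b'•v`. [cite: Jacobowitz1962, §4] -/
theorem pairing_decomp (σ : E →+* E) (H : Matrix (Fin 2) (Fin 2) E) (u v : Fin 2 → E) (a b a' b' : E) :
    pairing σ H (a • u + b • v) (a' • u + b' • v) =
      σ a * a' * pairing σ H u u + σ a * b' * pairing σ H u v + σ b * a' * pairing σ H v u + σ b * b' * pairing σ H v v := by
  simp only [map_add, LinearMap.map_smulₛₗ, LinearMap.add_apply, LinearMap.smul_apply, map_smul, smul_eq_mul]
  ring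

/-! ## §2 The line model and the form scalar -/

/-- **T3-E, ALGEBRAIC CORE: THE ELLIPTIC PLANE IS A LINE OVER ITS EIGEN-FIELD, AND ITS HERMITIAN FORM IS A TRACE FORM.**  For abstract fields `E`, `M`, ring maps
`jE : E →+* M`, `ρ Θ : M →+* M` with `ρ ∘ jE = jE`, `Θ ∘ jE = jE ∘ σ`, an element `lam ∈ M` with `lam² = jE t·lam − jE D`, `ρ lam = jE t − lam`, `Θ(lam)·lam = 1` and unique
coordinates `z = jE p + jE q·lam` on `M`, and a matrix `γ₂ ∈ GL₂(E)` of trace `t`, determinant `D ≠ 0` with `t² ≠ 4D`, without eigenvalue in `E`, unitary for `pairing σ H₂`: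
there are an additive `φ : E² → M` with `φ(c•x) = jE c·φ x`, bijective, `φ(γ₂ x) = lam·φ x`, and a scalar `h ∈ M` with `jE ⟨x, y⟩_{H₂} = h·Θ(φx)·φy + ρ(h·Θ(φx)·φy)` for all
`x, y` — the binders `(φ, hφs, hφi, hφo, hφγ, hform)` of ★ `EllipticPlaneAsFieldLine.ncard_selfDual_fixed_eq_ncard_orderLatt`.
[cite: Rogawski1990, §4.9 Lemma 4.9.3 p. 56] [cite: Jacobowitz1962, §4] -/
theorem exists_lineModel (σ : E →+* E) (H₂ : Matrix (Fin 2) (Fin 2) E) (jE : E →+* M) (ρ Θ : M →+* M)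
    (hρj : ∀ c, ρ (jE c) = jE c) (hΘj : ∀ c, Θ (jE c) = jE (σ c))
    {t D : E} (hD : D ≠ 0) (hΔ : t * t - 4 * D ≠ 0)
    {lam : M} (hlam : lam * lam = jE t * lam - jE D) (hρlam : ρ lam = jE t - lam) (hΘlam : Θ lam * lam = 1)
    (hcoord : ∀ z : M, ∃! pq : E × E, z = jE pq.1 + jE pq.2 * lam)
    (γ₂ : GL (Fin 2) E) (htr : (γ₂ : Matrix (Fin 2) (Fin 2) E) 0 0 + (γ₂ : Matrix (Fin 2) (Fin 2) E) 1 1 = t)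
    (hdet : (γ₂ : Matrix (Fin 2) (Fin 2) E) 0 0 * (γ₂ : Matrix (Fin 2) (Fin 2) E) 1 1 - (γ₂ : Matrix (Fin 2) (Fin 2) E) 0 1 * (γ₂ : Matrix (Fin 2) (Fin 2) E) 1 0 = D)
    (hirr : ∀ c : E, c * c - t * c + D ≠ 0)
    (hU : ∀ x y, pairing σ H₂ ((γ₂ : Matrix (Fin 2) (Fin 2) E).mulVec x) ((γ₂ : Matrix (Fin 2) (Fin 2) E).mulVec y) = pairing σ H₂ x y) :
    ∃ (φ : (Fin 2 → E) →+ M) (h : M),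
      (∀ (c : E) (x : Fin 2 → E), φ (c • x) = jE c * φ x) ∧ Function.Injective φ ∧ Function.Surjective φ ∧
      (∀ x, φ ((γ₂ : Matrix (Fin 2) (Fin 2) E).mulVec x) = lam * φ x) ∧
      (∀ x y, jE (pairing σ H₂ x y) = h * Θ (φ x) * φ y + ρ (h * Θ (φ x) * φ y)) := by
  -- names for the entries of `γ₂`
  set g : Matrix (Fin 2) (Fin 2) E := (γ₂ : Matrix (Fin 2) (Fin 2) E) with hg
  have hg10 : g 1 0 ≠ 0 := by
    intro h0
    apply hirr (g 0 0)
    have h11 : g 1 1 = t - g 0 0 := by rw [← htr]; ring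
    rw [h0, mul_zero, sub_zero, h11] at hdet
    linear_combination -hdet
  -- the basis `e₀ = (1,0)`, `v₁ = γ₂ e₀ = (g₀₀, g₁₀)` and the coordinates `a`, `b`
  set e₀ : Fin 2 → E := ![1, 0] with he₀
  set v₁ : Fin 2 → E := ![g 0 0, g 1 0] with hv₁
  have hmul : ∀ x : Fin 2 → E, g.mulVec x = ![g 0 0 * x 0 + g 0 1 * x 1, g 1 0 * x 0 + g 1 1 * x 1] := fun x => by
    ext i; fin_cases i <;> simp [Matrix.mulVec, dotProduct, Fin.sum_univ_two]
  have hv₁e : g.mulVec e₀ = v₁ := by rw [hmul]; simp [he₀, hv₁]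
  -- Cayley–Hamilton on `e₀`: `γ₂ v₁ = t v₁ − D e₀`
  have hCH : g.mulVec v₁ = t • v₁ - D • e₀ := by
    rw [hmul]; ext i; fin_cases i
    · simp [hv₁, he₀]; linear_combination g 0 0 * htr - hdet
    · simp [hv₁, he₀]; linear_combination g 1 0 * htr
  let bco : (Fin 2 → E) → E := fun x => x 1 / g 1 0
  let aco : (Fin 2 → E) → E := fun x => x 0 - x 1 / g 1 0 * g 0 0
  have hdecomp : ∀ x : Fin 2 → E, x = aco x • e₀ + bco x • v₁ := fun x => by
    ext i; fin_cases i
    · simp [aco, bco, he₀, hv₁]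
    · simp [aco, bco, he₀, hv₁]; field_simp
  -- the line model
  let φf : (Fin 2 → E) → M := fun x => jE (aco x) + jE (bco x) * lam
  have hφadd : ∀ x y, φf (x + y) = φf x + φf y := fun x y => by
    simp only [φf, aco, bco, Pi.add_apply]; rw [show (x 0 + y 0 - (x 1 + y 1) / g 1 0 * g 0 0) = (x 0 - x 1 / g 1 0 * g 0 0) + (y 0 - y 1 / g 1 0 * g 0 0) by ring,
      show (x 1 + y 1) / g 1 0 = x 1 / g 1 0 + y 1 / g 1 0 by ring, map_add, map_add]; ring
  let φ : (Fin 2 → E) →+ M := { toFun := φf, map_zero' := by simp [φf, aco, bco], map_add' := hφadd }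
  have hφ : ∀ x, φ x = jE (aco x) + jE (bco x) * lam := fun x => rfl
  have hφs : ∀ (c : E) (x : Fin 2 → E), φ (c • x) = jE c * φ x := fun c x => by
    rw [hφ, hφ]; simp only [aco, bco, Pi.smul_apply, smul_eq_mul]
    rw [show c * x 0 - c * x 1 / g 1 0 * g 0 0 = c * (x 0 - x 1 / g 1 0 * g 0 0) by ring, show c * x 1 / g 1 0 = c * (x 1 / g 1 0) by ring, map_mul, map_mul]; ring
  have hφe₀ : φ e₀ = 1 := by rw [hφ]; simp [aco, bco, he₀]
  have hφv₁ : φ v₁ = lam := by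
    rw [hφ]; simp only [aco, bco, hv₁, Matrix.cons_val_zero, Matrix.cons_val_one]
    rw [div_self hg10, show g 0 0 - 1 * g 0 0 = 0 by ring, map_zero, map_one]; ring
  -- `φ(γ₂ x) = lam · φ x`
  have hφγ : ∀ x, φ (g.mulVec x) = lam * φ x := fun x => by
    have hx := hdecomp x
    have h1 : g.mulVec x = aco x • v₁ + bco x • (t • v₁ - D • e₀) := by
      conv_lhs => rw [hx]
      rw [Matrix.mulVec_add, Matrix.mulVec_smul, Matrix.mulVec_smul, hv₁e, hCH]
    have h2 : g.mulVec x = (-(bco x * D)) • e₀ + (aco x + bco x * t) • v₁ := by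
      rw [h1]; ext i; simp only [Pi.add_apply, Pi.smul_apply, Pi.sub_apply, smul_eq_mul]; ring
    rw [h2, map_add, hφs, hφs, hφe₀, hφv₁, hφ, map_neg, map_mul, map_add, map_mul]
    have : jE (bco x) * lam * lam = jE (bco x) * (jE t * lam - jE D) := by rw [mul_assoc, hlam]
    linear_combination (-1 : M) * this
  -- injective ∕ surjective from the unique coordinates
  have hφi : Function.Injective φ := by
    intro x y hxy
    rw [hφ, hφ] at hxy
    have huniq := (hcoord (φ x)).unique (y₁ := (aco x, bco x)) (y₂ := (aco y, bco y)) (by rw [hφ]) (by rw [hφ, hxy])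
    have ha : aco x = aco y := congrArg Prod.fst huniq
    have hb : bco x = bco y := congrArg Prod.snd huniq
    rw [hdecomp x, hdecomp y, ha, hb]
  have hφo : Function.Surjective φ := by
    intro z
    obtain ⟨⟨p, q⟩, hpq, -⟩ := hcoord z
    refine ⟨![p + q * g 0 0, q * g 1 0], ?_⟩
    rw [hφ, hpq]; simp only [aco, bco, Matrix.cons_val_zero, Matrix.cons_val_one]
    rw [mul_div_cancel_right₀ q hg10, show p + q * g 0 0 - q * g 0 0 = p by ring]
  -- the Gram data on the basis
  set A : E := pairing σ H₂ e₀ e₀ with hA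
  set B : E := pairing σ H₂ e₀ v₁ with hB
  set B' : E := pairing σ H₂ v₁ e₀ with hB'
  have hA' : pairing σ H₂ v₁ v₁ = A := by rw [hA, ← hv₁e]; exact hU e₀ e₀
  -- unitarity: `D · ⟨v₁, e₀⟩ = tA − B` (from `γ₂ (t e₀ − v₁) = D e₀`)
  have hgy : g.mulVec (t • e₀ - v₁) = D • e₀ := by
    rw [Matrix.mulVec_sub, Matrix.mulVec_smul, hv₁e, hCH]; ext i; simp only [Pi.sub_apply, Pi.smul_apply, smul_eq_mul]; ring
  have hB'D : D * B' = t * A - B := by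
    have hu := hU e₀ (t • e₀ - v₁)
    rw [hv₁e, hgy, map_smul, smul_eq_mul, map_sub, map_smul, smul_eq_mul] at hu
    rw [hB', hA, hB]; linear_combination hu
  -- `T(m) := m + ρ m` is `jE`-linear
  have hT : ∀ (c : E) (m : M), jE c * m + ρ (jE c * m) = jE c * (m + ρ m) := fun c m => by rw [map_mul, hρj]; ring
  -- `jE D · Θ(lam) = ρ lam`
  have hΘlam' : jE D * Θ lam = jE t - lam := by
    have h1 : lam * (jE t - lam) = jE D := by linear_combination -hlam
    calc jE D * Θ lam = Θ lam * lam * (jE t - lam) := by rw [mul_assoc, h1, mul_comm]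
      _ = jE t - lam := by rw [hΘlam, one_mul]
  -- the form scalar
  set Δ : E := t * t - 4 * D with hΔdef
  set p : E := (A * t * t - 2 * A * D - t * B) / Δ with hp
  set q : E := (2 * B - t * A) / Δ with hq
  have hpq1 : 2 * p + q * t = A := by rw [hp, hq]; field_simp; ring
  have hpq2 : p * t + q * (t * t - 2 * D) = B := by rw [hp, hq]; field_simp; ring
  set h : M := jE p + jE q * lam with hh
  -- the four values of `T(h · Θ(φ u) · φ u')` on the basis
  have hT1 : h + ρ h = jE A := by
    rw [hh, map_add, map_mul, hρj, hρj, hρlam, ← hpq1]; simp only [map_add, map_mul, map_ofNat]; ring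
  have hT2 : h * lam + ρ (h * lam) = jE B := by
    have hρll : ρ (lam * lam) = (jE t - lam) * (jE t - lam) := by rw [map_mul, hρlam]
    have e1 : h * lam = jE p * lam + jE q * (lam * lam) := by rw [hh]; ring
    rw [e1, map_add, map_mul, map_mul, hρj, hρj, hρlam, hρll, ← hpq2]; simp only [map_add, map_mul, map_sub, map_ofNat]
    linear_combination (2 * jE q) * hlam
  have hT3 : h * Θ lam + ρ (h * Θ lam) = jE B' := by
    have hD' : jE D ≠ 0 := (map_ne_zero jE).2 hD
    apply mul_left_cancel₀ hD'
    have e1 : jE D * (h * Θ lam) = jE t * h - h * lam := by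
      calc jE D * (h * Θ lam) = h * (jE D * Θ lam) := by ring
        _ = jE t * h - h * lam := by rw [hΘlam']; ring
    rw [← hT D, e1, map_sub, map_mul, hρj, ← map_mul, hB'D, map_sub, map_mul, map_mul, ← hT1, ← hT2]
    simp only [map_mul]
    ring
  have hT4 : h * (Θ lam * lam) + ρ (h * (Θ lam * lam)) = jE A := by rw [hΘlam, mul_one, hT1]
  refine ⟨φ, h, hφs, hφi, hφo, hφγ, fun x y => ?_⟩
  -- expand both sides along `x = a e₀ + b v₁`, `y = a' e₀ + b' v₁`
  have hx := hdecomp x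
  have hy := hdecomp y
  have hL : pairing σ H₂ x y = σ (aco x) * aco y * A + σ (aco x) * bco y * B + σ (bco x) * aco y * B' + σ (bco x) * bco y * A := by
    conv_lhs => rw [hx, hy]
    rw [pairing_decomp, hA']
  have hφx : Θ (φ x) = jE (σ (aco x)) + jE (σ (bco x)) * Θ lam := by rw [hφ, map_add, map_mul, hΘj, hΘj]
  have hφy : φ y = jE (aco y) + jE (bco y) * lam := hφ y
  have hS : h * Θ (φ x) * φ y =
      jE (σ (aco x) * aco y) * h + jE (σ (aco x) * bco y) * (h * lam) + jE (σ (bco x) * aco y) * (h * Θ lam) +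
        jE (σ (bco x) * bco y) * (h * (Θ lam * lam)) := by
    rw [hφx, hφy, map_mul, map_mul, map_mul, map_mul]; ring
  have hR : h * Θ (φ x) * φ y + ρ (h * Θ (φ x) * φ y) =
      jE (σ (aco x) * aco y) * (h + ρ h) + jE (σ (aco x) * bco y) * (h * lam + ρ (h * lam)) +
        jE (σ (bco x) * aco y) * (h * Θ lam + ρ (h * Θ lam)) + jE (σ (bco x) * bco y) * (h * (Θ lam * lam) + ρ (h * (Θ lam * lam))) := by
    rw [hS]; simp only [map_add, map_mul, hρj]; ring
  rw [hR, hT1, hT2, hT3, hT4, hL]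
  simp only [map_add, map_mul]

end Summit.HodgeConjecture.HodgeConjecture.Cruxes.H413.F0P3cDyRamEllipticPlaneLineModel

end
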